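import Summits.BirchSwinnertonDyer.BirchSwinnertonDyer.Theorems.ByReductionTypeAtTwoTorsionEulerCharCoinvDefect
import HarnessLib

set_option linter.dupNamespace false -- `…BirchSwinnertonDyer.BirchSwinnertonDyer…` is the cell's nested layout (D-0017)
set_option autoImplicit false

/-!
# Greenberg LNM 1716 Lemma 4.7 WITH RATIONAL `p`-TORSION, part 3c: THE INEQUALITY
# `(∏_{v∈S} #𝒦_{v,0}[p^∞]) · #(Sel_{p^∞}(E/K_∞))_γ ≤ #(A₀/Sel₀) · #C` (no hypothesis on `E(K)[p]`)

Cell `bsd-2adic` (run/shared/lean/pub/bsd-2adic/), seat `bsd-2adic-tower-1` GEN 31; `--supports stmt-BirchSwinnertonDyer-19271`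
(helper). THEOREMS ONLY (no definition, no named fact, no `sorry`); closes no item; nothing booked; BSD is not proved by any of this.

R. Greenberg, *Iwasawa theory for elliptic curves*, LNM 1716 (1999), §4 Lemma 4.7 (pp. 107–108): `|ker g|·|E(F)_p| =
|ker r|·|(Sel_E(F_∞)_p)_Γ|`. This file multiplies parts 1–3b into the HALF of Lemma 4.7 that does not use Lemma 4.6: for every
number field `K`, prime `p`, `W/K` elliptic, the CYCLOTOMIC `ℤ_p`-extension `κ` with topological generator `γ`, `Sel_{p^∞}(E/K)`
finite, «DIV» for `H¹(K_∞, E[p^∞])`, Greenberg's local surjectivity at every finite place (p. 108), a finite `S ⊇ {bad} ∪ {v ∣ p}`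
with the `𝒦_{v,0}[p^∞]` finite on `S`, an auxiliary place `v₀ ∉ S`, and ANY additive `δ` on `H¹(Γ_{K_{v₀}}, E)(p)` into a finite `C`
with kernel `loc_{v₀}(U)`:

  **`(∏_{v ∈ S} #𝒦_{v,0}[p^∞]) · #(Sel_{p^∞}(E/K_∞))_γ ≤ #(A₀/Sel₀) · #C`**.

For the projection onto `C_{v₀} = H¹(Γ_{K_{v₀}}, E)(p)/loc_{v₀}(U)` (Cassels' cokernel `𝒫^{S∪{v₀}}(K)/𝒢(K)` read at `v₀`),
Cassels' theorem with torsion (Prop. 4.13, p. 122) bounds `#C_{v₀}` by `#E(K)[p^∞]` (sequel), giving with Lemmas 4.2/4.3 (tree,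
`SelmerDualData.constantCoeff_charGenerator_mul_natCard_of_finite_selmerGroup`) the «upper-half» direction
`ord_p f_E(0) + 2·ord_p #E(K)_p ≥ ord_p #Sel_{p^∞}(E/K) + ord_p ∏_{v∈S} #𝒦_{v,0}` of Theorem 4.1 and of its multiplicative
analogue (p. 112). The reverse inequality is Lemma 4.6 on `Γ`-invariants — NOT claimed.

* `prod_natCard_mul_natCard_endCoinvariants_le` — the inequality.

HONEST FRAMING: kernel-checked index calculus over tree theorems; one half of a printed lemma. Closes no item; no summit
statement is proved; the Birch–Swinnerton-Dyer conjecture is NOT proved by any of this.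

References: [GreenbergLNM1716] §4 p. 104, Lemmas 4.6–4.7 (pp. 105–108), Prop. 4.13 and p. 123; [GreenbergVatsal2000] §2
pp. 16–17; [MilneADT2006] I Thm. 4.10, Thm. 6.13.
-/

noncomputable section

open scoped Classical NumberField

open NumberField IsDedekindDomain Field

namespace Summit.BirchSwinnertonDyer.BirchSwinnertonDyer.Theorems.TorsionEulerChar

open Literature.NumberTheory.EllipticCurves Literature.NumberTheory.GaloisRepresentations
  WeierstrassCurve ZpExtension Literature.NumberTheory.EllipticCurves.IwasawaAlgebra
  Literature.NumberTheory.EllipticCurves.IwasawaDual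
  Literature.NumberTheory.EllipticCurves.GreenbergVatsal2000 Literature.NumberTheory.EllipticCurves.GreenbergSelmer
  Literature.NumberTheory.EllipticCurves.Rank1Residual Summit.BirchSwinnertonDyer.Rank1Residual.X2

/-! ## §1 The inequality -/

variable {K : Type} [Field K] [NumberField K] (W : WeierstrassCurve K) [W.IsElliptic] (p : ℕ) [hp : Fact p.Prime]
  (κ : ZpExtension K p) {γ : absoluteGaloisGroup K}


/-- **Greenberg LNM 1716 Lemma 4.7 WITH RATIONAL `p`-TORSION — the half that does not need Lemma 4.6.** For `W/K` elliptic
over a number field, `κ` the CYCLOTOMIC `ℤ_p`-extension with topological generator `γ`, `Sel_{p^∞}(E/K)` finite, «DIV» for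
`H¹(K_∞, E[p^∞])` (`hdiv`), the local surjectivity `𝒫_E(K_v)[p^∞] ↠ 𝒫_E(K_{∞,η})[p^∞]^{Γ_v}` at every finite place (`hsurj`),
a finite `S` off which `E` has good reduction and `v ∤ p`, an auxiliary `v₀ ∉ S`, and ANY additive map `δ` on
`H¹(Γ_{K_{v₀}}, E)(p)` into a FINITE group `C` whose kernel is exactly `loc_{v₀}(U)`, `U ≤ H¹(Γ_K, E[p^∞])` the classes unramified
outside `S ∪ {v₀}` with local class `0` on `S` and at `∞` (the receptacle for Cassels' cokernel at `v₀`; e.g. `C =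
H¹(Γ_{K_{v₀}}, E)(p) / loc_{v₀}(U)` with `δ` the projection): **`(∏_{v ∈ S} #𝒦_{v,0}[p^∞]) · #(Sel_{p^∞}(E/K_∞))_γ ≤ #(A₀/Sel₀) · #C`**.
NO hypothesis on `E(K)[p]`. (`#C ≤ #E(K)[p^∞]` for the projection is Cassels' theorem with torsion, Prop. 4.13; the reverse
inequality is Lemma 4.6^Γ — neither is claimed here.)
[cite: GreenbergLNM1716, §4 p. 104, Lemma 4.7 (pp. 107–108), Prop. 4.13 (p. 122) and p. 123] -/
theorem prod_natCard_mul_natCard_endCoinvariants_le {C : Type*} [AddCommGroup C] [Finite C]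
    (hκ : κ.IsCyclotomic) (hγ : κ.IsTopGenerator γ) (hSel : Finite (W.selmerGroupPInfty p))
    (hdiv : ∀ s : W.subgroupH1 p κ.kerSubgroup,
      ∃ t : W.subgroupH1 p κ.kerSubgroup, W.conjH1 p κ.kerSubgroup γ t - t = s)
    (hsurj : ∀ (v : HeightOneSpectrum (𝓞 K))
      (c : discreteH1 (localSubgroup κ.kerSubgroup (v.adicCompletion K)) (localPoints W (v.adicCompletion K))),
      (∃ k : ℕ, p ^ k • c = 0) →
      (∀ δ : absoluteGaloisGroup (v.adicCompletion K),
        Literature.NumberTheory.EllipticCurves.conjH1 (localSubgroup κ.kerSubgroup (v.adicCompletion K))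
          (localPoints W (v.adicCompletion K)) δ c = c) →
      ∃ x : discreteH1 (localSubgroup (⊤ : Subgroup (absoluteGaloisGroup K)) (v.adicCompletion K))
          (localPoints W (v.adicCompletion K)),
        (∃ k : ℕ, p ^ k • x = 0) ∧
        Literature.NumberTheory.EllipticCurves.resOfLe (localPoints W (v.adicCompletion K))
          (Subgroup.comap_mono le_top :
            localSubgroup κ.kerSubgroup (v.adicCompletion K) ≤
              localSubgroup (⊤ : Subgroup (absoluteGaloisGroup K)) (v.adicCompletion K)) x = c)
    (S : Finset (HeightOneSpectrum (𝓞 K))) (hS : ∀ v ∉ S, ((p : ℕ) : 𝓞 K) ∉ v.asIdeal ∧ W.HasGoodReductionAt v)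
    (v₀ : HeightOneSpectrum (𝓞 K)) (hv₀ : v₀ ∉ S)
    (δ : AddCommGroup.primaryComponent
      (discreteH1 (localSubgroup (⊤ : Subgroup (absoluteGaloisGroup K)) (v₀.adicCompletion K))
        (localPoints W (v₀.adicCompletion K))) p →+ C)
    (hδ : ∀ z : AddCommGroup.primaryComponent
        (discreteH1 (localSubgroup (⊤ : Subgroup (absoluteGaloisGroup K)) (v₀.adicCompletion K))
          (localPoints W (v₀.adicCompletion K))) p, δ z = 0 ↔
      (z : discreteH1 (localSubgroup (⊤ : Subgroup (absoluteGaloisGroup K)) (v₀.adicCompletion K))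
        (localPoints W (v₀.adicCompletion K))) ∈
        AddSubgroup.map (W.localResOver p ⊤ (v₀.adicCompletion K))
          (unramifiedOutside (⊤ : Subgroup (absoluteGaloisGroup K)) (W.geomPrimaryTorsion p) p
              ((↑S : Set (HeightOneSpectrum (𝓞 K))) ∪ {v₀}) ⊓
            (⨅ v ∈ S, W.localKerOver p ⊤ (v.adicCompletion K)) ⊓
            (⨅ w : InfinitePlace K, W.localKerOver p ⊤ w.Completion)))
    (hT : ∀ v ∈ S, Finite (W.localTowerKerPrimary κ (v.adicCompletion K) 0)) :
    (∏ v ∈ S, Nat.card (W.localTowerKerPrimary κ (v.adicCompletion K) 0)) *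
        Nat.card (EndCoinvariants (W.conjSelmerInfty κ γ - 1)) ≤ Nat.card (W.KerG κ 0) * Nat.card C := by
  classical
  let Pv := discreteH1 (localSubgroup (⊤ : Subgroup (absoluteGaloisGroup K)) (v₀.adicCompletion K))
    (localPoints W (v₀.adicCompletion K))
  let P₀ : AddSubgroup Pv := AddCommGroup.primaryComponent Pv p
  let U : AddSubgroup (W.subgroupH1 p (⊤ : Subgroup (absoluteGaloisGroup K))) :=
    unramifiedOutside (⊤ : Subgroup (absoluteGaloisGroup K)) (W.geomPrimaryTorsion p) p
        ((↑S : Set (HeightOneSpectrum (𝓞 K))) ∪ {v₀}) ⊓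
      (⨅ v ∈ S, W.localKerOver p ⊤ (v.adicCompletion K)) ⊓
      (⨅ w : InfinitePlace K, W.localKerOver p ⊤ w.Completion)
  have hle : ∀ (E : Type) [Field E] [Algebra K E],
      localSubgroup κ.kerSubgroup E ≤ localSubgroup (⊤ : Subgroup (absoluteGaloisGroup K)) E :=
    fun E _ _ ↦ Subgroup.comap_mono le_top
  have hU : ∀ u : W.subgroupH1 p (⊤ : Subgroup (absoluteGaloisGroup K)), u ∈ U ↔
      u ∈ unramifiedOutside (⊤ : Subgroup (absoluteGaloisGroup K)) (W.geomPrimaryTorsion p) p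
          ((↑S : Set (HeightOneSpectrum (𝓞 K))) ∪ {v₀}) ∧
        (∀ v ∈ S, W.localResOver p ⊤ (v.adicCompletion K) u = 0) ∧
        ∀ w : InfinitePlace K, W.localResOver p ⊤ w.Completion u = 0 := by
    intro u
    simp only [U, AddSubgroup.mem_inf, AddSubgroup.mem_iInf, and_assoc]
    exact Iff.rfl
  -- part 1: the embedding `Ψ : A₀/Sel₀ ↪ ∏ 𝒦` and its range criterion
  obtain ⟨Ψ, hΨinj, hΨrange⟩ := exists_kerG_embedding W p κ hκ S hS v₀ hv₀
  -- the classes `Θ` realising `∏ 𝒦` (sealed)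
  obtain ⟨Θ, hΘ⟩ : ∃ Θ : AddSubgroup (W.subgroupH1 p (⊤ : Subgroup (absoluteGaloisGroup K))),
      ∀ Y : W.subgroupH1 p (⊤ : Subgroup (absoluteGaloisGroup K)), Y ∈ Θ ↔
        Y ∈ unramifiedOutside (⊤ : Subgroup (absoluteGaloisGroup K)) (W.geomPrimaryTorsion p) p
            ((↑S : Set (HeightOneSpectrum (𝓞 K))) ∪ {v₀}) ∧
          (∀ v ∈ S, Literature.NumberTheory.EllipticCurves.resOfLe (localPoints W (v.adicCompletion K))
            (hle (v.adicCompletion K)) (W.localResOver p ⊤ (v.adicCompletion K) Y) = 0) ∧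
          ∀ w : InfinitePlace K, W.localResOver p ⊤ w.Completion Y = 0 :=
    ⟨unramifiedOutside (⊤ : Subgroup (absoluteGaloisGroup K)) (W.geomPrimaryTorsion p) p
          ((↑S : Set (HeightOneSpectrum (𝓞 K))) ∪ {v₀}) ⊓
        (⨅ v ∈ S, ((Literature.NumberTheory.EllipticCurves.resOfLe (localPoints W (v.adicCompletion K))
          (hle (v.adicCompletion K))).comp (W.localResOver p ⊤ (v.adicCompletion K))).ker) ⊓
        (⨅ w : InfinitePlace K, W.localKerOver p ⊤ w.Completion),
      fun Y ↦ by
        simp only [AddSubgroup.mem_inf, AddSubgroup.mem_iInf, and_assoc]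
        exact Iff.rfl⟩
  -- `lamP : Θ → P₀`, `Y ↦ loc_{v₀} Y` (sealed)
  have hmemP : ∀ Y : W.subgroupH1 p (⊤ : Subgroup (absoluteGaloisGroup K)),
      W.localResOver p ⊤ (v₀.adicCompletion K) Y ∈ P₀ := fun Y ↦ by
    obtain ⟨k, hk⟩ := SignedEC.H1SigmaCorank.exists_pow_smul_eq_zero_subgroupH1_top W p Y
    exact (AddCommGroup.mem_primaryComponent).mpr ⟨k, by rw [← map_nsmul, hk, map_zero]⟩
  obtain ⟨lamP, hlamP⟩ : ∃ lamP : Θ →+ P₀, ∀ Y : Θ, (lamP Y : Pv) = W.localResOver p ⊤ (v₀.adicCompletion K) Y :=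
    ⟨((W.localResOver p ⊤ (v₀.adicCompletion K)).comp Θ.subtype).codRestrict P₀ fun Y ↦ hmemP Y, fun _ ↦ rfl⟩
  -- (I), (II), Lagrange
  have hI := natCard_pi_le_of_defect W p κ hSel S hS v₀ hv₀ Ψ hΨrange Θ hΘ U hU P₀ lamP hlamP δ hδ hT
  have hII := natCard_endCoinvariants_le_of_defect W p κ hκ hγ hSel hdiv hsurj S hS v₀ hv₀ Θ hΘ U hU lamP hlamP δ hδ
  have h1 : ∏ v ∈ S, Nat.card (W.localTowerKerPrimary κ (v.adicCompletion K) 0) =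
      Nat.card (∀ v : S, W.localTowerKerPrimary κ (v.1.adicCompletion K) 0) := by
    rw [← Finset.prod_coe_sort S (fun v ↦ Nat.card (W.localTowerKerPrimary κ (v.adicCompletion K) 0)), ← Nat.card_pi]
  have hΨ : Nat.card Ψ.range = Nat.card (W.KerG κ 0) := Nat.card_congr (Ψ.ofInjective hΨinj).toEquiv.symm
  have hDC : Nat.card C = Nat.card (C ⧸ (δ.comp lamP).range) * Nat.card (δ.comp lamP).range :=
    (δ.comp lamP).range.card_eq_card_quotient_mul_card_addSubgroup
  calc (∏ v ∈ S, Nat.card (W.localTowerKerPrimary κ (v.adicCompletion K) 0)) *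
          Nat.card (EndCoinvariants (W.conjSelmerInfty κ γ - 1))
        = Nat.card (∀ v : S, W.localTowerKerPrimary κ (v.1.adicCompletion K) 0) *
          Nat.card (EndCoinvariants (W.conjSelmerInfty κ γ - 1)) := by rw [h1]
    _ ≤ Nat.card Ψ.range * Nat.card (δ.comp lamP).range * Nat.card (C ⧸ (δ.comp lamP).range) :=
          Nat.mul_le_mul hI hII
    _ = Nat.card (W.KerG κ 0) * Nat.card C := by rw [hΨ, hDC, mul_assoc, mul_comm (Nat.card (δ.comp lamP).range)]

end Summit.BirchSwinnertonDyer.BirchSwinnertonDyer.Theorems.TorsionEulerChar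

end
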